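import Literature.MathematicalPhysics.QuantumFieldTheory.Balaban1983to89.B9RWSumsDefinitePinsPairMDir
import Literature.MathematicalPhysics.QuantumFieldTheory.Balaban1983to89.B9RWSumsAllBlocksPairMGDir

/-!
# `Balaban1983to89.B9RWSumsDefinitePinsPairMDirA` — rows 13 ∕ 18 ∕ 19 at def-Y's members with definite expansion data, BOTH SIDES OVER THE DIRECTION LETTERS
# (R1′ + R1′-A): `thm310Printed_exp261_of_rowSum261₂ ∕ thm310Printed_exp261_geo9Y₂` (v1 `B9RWSums347DefiniteFaces`), `thm310_complete_geo9Y_pairM_dir`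
# (v1 `B9RWSumsCompleteGeo9YPairM`), ★★★ `rows131819_definite_geo9Y_pairM_dir₂` (v1 `B9RWSumsDefinitePinsPairM` — the consumer face, A side re-threaded too)

T. Bałaban, *Propagators for lattice gauge theories in a background field*, Commun. Math. Phys. **99** (1985) 389–434
[`Balaban1985BackgroundPropagators`, "B9"], Thm 3.7 p. 409, Cor. 3.8 p. 410, Thm 3.10 (3.105)–(3.108) pp. 414–416, Thm 3.10 ⇒ Thm 3.3 p. 416, (3.42)–(3.47)
pp. 397–398, Cor. 3.6 p. 408; T. Bałaban, *Propagators and renormalization transformations for lattice gauge theories. II*, Commun. Math. Phys. **96** (1984)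
223–250 [`Balaban1984PropagatorsII`, "[4]"], (2.51)–(2.52) p. 232, Lemma 2.1 (2.59)–(2.61) pp. 233–234.

statement-level skeleton of published theorems with citation tags; proofs where landed; nothing here is a claim about the
Yang–Mills mass gap

WHY THIS FILE (cell `pub-ymgap`, Track A node N06 [B9]; seat `pub-ymgap-dag-n06-c` g10, LOCATED-9 bus l.32219).  `B9RWSumsDefinitePinsPairMDir.rows131819_definite_geo9Y_pairM_dir`
re-threads the G′ side (row 18's `h36 ∋ Identities₂`); the G side's `h36A ∋ Identities310` carries the same un-instantiable Laplacian-Leibniz clause (def-Y OBS-2),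
so here the A side is re-threaded as well: `h36A ∋ DirSupSq310 ∧ Identities310₂ (𝔬A x) (𝔡A x) (𝔩A x)` with the new letter family `𝔩A : DirLetters310`, through
`B9Thm310WholeDir.thm310Printed_of_local3107₂` and `B9RWSumsAllBlocksPairMGDir.thm310Printed_allPin_completePairM_dir`.  The E-letters (`E37YPairMDir`,
`E310YPairM`), the sign records, `B1PairM`, δ₁ and every numeric relation VERBATIM (the private arithmetic helpers are copied).

HONEST SCOPE.  Bookkeeping composition; every operator-level input is a HYPOTHESIS schema; nothing of [B9] asserted; COUNT-NEUTRAL; N06 NOT discharged; one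
finite lattice programme — nothing continuum, nothing about OS positivity or the mass gap.
-/

namespace Literature.MathematicalPhysics.QuantumFieldTheory.Balaban1983to89.B9RWSumsDefinitePinsPairMDirA

open Finset B6RandomWalk B9Thm34Ext B9Thm37Whole B9Cor38Whole B9Thm310Whole B9RowSum261Faces B9RowSum261DefiniteFaces
open B9Ineq349Whole B9RWSums343to347Whole B9PinMembersKLevelV1 B9GeoLemma21KLevelV1 B9RWSums347DefiniteFaces
open B9Thm37GlueCor36 B9Thm37Glue B9RWSums346Schur B9RWSums343Holder B9RWSums343HolderGp B9RWSums346Lap B9RWSums344Input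
open B9RWSums344InputGp B9RWSums346Two B9RWSums346TwoGp B11SectG B9RWSumsCompleteGeo9Y B9RWSumsDefinitePins
open B9CoRealizesRel B9RWSumsReadsRel B9RWSumsReadsNbr B9RWSumsAllBlocksNbr B9RWSumsCompleteGeo9YNbr
open B9RWSums346SecondDiff B9RWSums346SecondDiffGp B9RWSumsAllBlocksPair B9RWSumsCompleteGeo9YPair
open B9RWSumsDefinitePinsNbr B9RWSumsDefinitePinsPair B9RWSums346MixedPair B9RWSums344InputFam B9RWSums344InputPair B9RWSumsAllBlocksPairM
open B9RWSumsCompleteGeo9YPairM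
open B9RWSumsCompleteGeo9YPairM B9RWSumsDefinitePinsPairM
open Literature.MathematicalPhysics.QuantumFieldTheory.Balaban1983to89.B9RWSumsCompleteGeo9Y (const37_nonneg_of_signs)
open B9Thm37WholeDir B9Thm37KLetterDir B9RWSums343HolderGpDir B9RWSumsAllBlocksPairMDir B9Cor38WholeDir B9RWSumsDefinitePinsPairMDir
open B9Thm310WholeDir B9RWSums343HolderDir B9RWSumsAllBlocksPairMGDir

noncomputable section

/-! ## §1 Theorem 3.10 as the whole printed leaf at the definite exponent, over the direction letters -/

section Faces

variable {I : Type} {c35 : ℝ} {geo : I → B9.Geometry} {bg : I → B9.Backgrounds}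
variable [∀ i, Fintype (geo i).Site] [∀ i, DecidableEq (geo i).Site]
variable {X Y ι A Dir : I → Type} [∀ i, Fintype (X i)] [∀ i, DecidableEq (X i)] [∀ i, Fintype (Y i)]
  [∀ i, DecidableEq (Y i)] [∀ i, Fintype (ι i)] [∀ i, Fintype (A i)] [∀ i, Fintype (Dir i)]

/-- ★ **(v2, R1′-A: `h36 ∋ DirSupSq310 ∧ Identities310₂`, via `thm310Printed_of_local3107₂`.) THEOREM 3.10 AS THE WHOLE PRINTED LEAF AT THE DEFINITE EXPONENT, (2.61) SUPPLIED BY `RowSum261`** (pp. 415–416: *"For M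
sufficiently large, and a configuration U satisfying (3.35), the operator G has the expansion G = Σ_ω R₀(X₀)R_{α₁}(X₁)·⋯·R_{αₙ}(Xₙ),
(3.107) …"*): this seat's `B9Thm310Whole.thm310Printed_of_local3107` through the door at `exp261 geo δ₀ α` — `B9.Thm310Printed c35
geo bg (fun i => W310OfOps (𝔬 i) (rd i) (Conv3107 (𝔬 i) (R i) (H i) (const37 (exp261 geo δ₀ α) δ₀ α ρ B₀ N N′ C_ℓ K) ((1 − 2α)δ₀)))`,
a LITERAL datum.  Needs 0 < α ≦ ½, 0 < δ₀; every other input VERBATIM. [cite: Balaban1985BackgroundPropagators, Thm 3.10 (3.107)–(3.108) pp.415–416 + (3.35) p.396; Balaban1984PropagatorsII, Lemma 2.1 (2.61) p.234] -/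
theorem thm310Printed_exp261_of_rowSum261₂ (𝔬 : ∀ i, Ops310 (geo i) (bg i) (X i) (Y i) (ι i) (A i))
    (𝔡 : ∀ i, DirOps310 (𝔬 i) (Dir i)) (𝔩 : ∀ i, DirLetters310 (𝔬 i) (Dir i))
    (rd : ∀ i, WalkReading310 (geo i) (bg i) (X i) (ι i) (A i)) (R : I → ℝ) (H : I → Prop)
    (κ : I → Sizes310) (α ρ N N' NF Cℓ K θ₀ B₀ δ₀ a₁ M₁ : ℝ)
    (hc : 0 < c35) (hα : 0 < α) (hα2 : α ≤ 1 / 2) (hN : 0 ≤ N) (hN' : 0 ≤ N') (hNF : 0 ≤ NF) (hCℓ : 1 ≤ Cℓ)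
    (hK : 0 ≤ K) (hθ₀ : 0 ≤ θ₀) (hB₀ : 0 < B₀) (hδ₀ : 0 < δ₀) (ha₁ : 0 < a₁) (hM₁ : 0 < M₁)
    (hst : ∀ i, StaticOK310 (𝔬 i) ρ N N' NF Cℓ (κ i)) (hκ : ∀ i, (κ i).Bounded K)
    (hrd : ∀ i, (rd i).OK (𝔬 i).blk) (hloc : ∀ i, Locality310 (𝔬 i) (rd i))
    (hrow : RowSum261 geo)
    (h36 : ∀ i, M₁ ≤ (geo i).M → ∀ α₀ : ℝ, 0 < α₀ → c35 * (geo i).M * α₀ ≤ a₁ →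
      ∀ U : (bg i).Cfg, (bg i).Reg335 c35 α₀ U →
        Local342G (𝔬 i) (R i) (H i) B₀ δ₀ U ∧ B9Thm310Whole.Factors389 (𝔬 i) (R i) (H i) θ₀ δ₀ U ∧
          DirSupSq310 (𝔬 i) (𝔡 i) (R i) (H i) U ∧ Identities310₂ (𝔬 i) (𝔡 i) (𝔩 i) (R i) (H i) U) :
    B9.Thm310Printed c35 geo bg
      (fun i => W310OfOps (𝔬 i) (rd i)
        (Conv3107 (𝔬 i) (R i) (H i) (const37 (exp261 geo δ₀ α) δ₀ α ρ B₀ N N' Cℓ K) ((1 - 2 * α) * δ₀))) := by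
  obtain ⟨ML, h261⟩ := ineq261_exp261_of_rowSum261 (geo := geo) R H (mul_pos hα hδ₀) hrow
  exact thm310Printed_of_local3107₂ 𝔬 𝔡 𝔩 rd R H κ _ α ρ N N' NF Cℓ K θ₀ B₀ δ₀ a₁ M₁ ML hc hα.le hα2 hN hN' hNF hCℓ
    hK hθ₀ hB₀ hδ₀ ha₁ hM₁ hst hκ hrd hloc h261 h36

end Faces

section FacesY

variable {d ℓ : ℕ} {hd : 1 ≤ d + 1} {hL : Odd (ℓ + 1) ∧ 1 < ℓ + 1} {b₀ b₁ : ℝ} {Mstar : ℕ}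
variable [∀ x : MemberY d ℓ hd hL b₀ b₁ Mstar, Fintype (geo9Y x).Site]
  [∀ x : MemberY d ℓ hd hL b₀ b₁ Mstar, DecidableEq (geo9Y x).Site]
variable {c35 : ℝ} {bg : MemberY d ℓ hd hL b₀ b₁ Mstar → B9.Backgrounds}
variable {X Y ι A Dir : MemberY d ℓ hd hL b₀ b₁ Mstar → Type} [∀ x, Fintype (X x)] [∀ x, DecidableEq (X x)]
  [∀ x, Fintype (Y x)] [∀ x, DecidableEq (Y x)] [∀ x, Fintype (ι x)] [∀ x, Fintype (A x)] [∀ x, Fintype (Dir x)]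

/-- ★ **(v2, R1′-A.) ROW 19 (t310) AT THE RECORD GEOMETRY WITH NO (2.61) BINDER**: Theorem 3.10 as the whole printed leaf at the literal datum
`W310OfOps (𝔬 x) (rd x) (Conv3107 (𝔬 x) (R x) (H x) (const37 (exp261 geo9Y δ₀ α) …) ((1 − 2α)δ₀))` over def-Y's members — (2.61)
from n06-i's `rowSum261_geo9Y` BY NAME. [cite: Balaban1985BackgroundPropagators, Thm 3.10 (3.107)–(3.108) pp.415–416 + (3.35) p.396; Balaban1984PropagatorsII, Lemma 2.1 (2.61) p.234] -/
theorem thm310Printed_exp261_geo9Y₂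
    (𝔬 : ∀ x : MemberY d ℓ hd hL b₀ b₁ Mstar, Ops310 (geo9Y x) (bg x) (X x) (Y x) (ι x) (A x))
    (𝔡 : ∀ x : MemberY d ℓ hd hL b₀ b₁ Mstar, DirOps310 (𝔬 x) (Dir x)) (𝔩 : ∀ x : MemberY d ℓ hd hL b₀ b₁ Mstar, DirLetters310 (𝔬 x) (Dir x))
    (rd : ∀ x : MemberY d ℓ hd hL b₀ b₁ Mstar, WalkReading310 (geo9Y x) (bg x) (X x) (ι x) (A x))
    (R : MemberY d ℓ hd hL b₀ b₁ Mstar → ℝ) (H : MemberY d ℓ hd hL b₀ b₁ Mstar → Prop)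
    (κ : MemberY d ℓ hd hL b₀ b₁ Mstar → Sizes310) (α ρ N N' NF Cℓ K θ₀ B₀ δ₀ a₁ M₁ : ℝ)
    (hc : 0 < c35) (hα : 0 < α) (hα2 : α ≤ 1 / 2) (hN : 0 ≤ N) (hN' : 0 ≤ N') (hNF : 0 ≤ NF) (hCℓ : 1 ≤ Cℓ)
    (hK : 0 ≤ K) (hθ₀ : 0 ≤ θ₀) (hB₀ : 0 < B₀) (hδ₀ : 0 < δ₀) (ha₁ : 0 < a₁) (hM₁ : 0 < M₁)
    (hst : ∀ x, StaticOK310 (𝔬 x) ρ N N' NF Cℓ (κ x)) (hκ : ∀ x, (κ x).Bounded K)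
    (hrd : ∀ x, (rd x).OK (𝔬 x).blk) (hloc : ∀ x, Locality310 (𝔬 x) (rd x))
    (h36 : ∀ x, M₁ ≤ (geo9Y x).M → ∀ α₀ : ℝ, 0 < α₀ → c35 * (geo9Y x).M * α₀ ≤ a₁ →
      ∀ U : (bg x).Cfg, (bg x).Reg335 c35 α₀ U →
        Local342G (𝔬 x) (R x) (H x) B₀ δ₀ U ∧ B9Thm310Whole.Factors389 (𝔬 x) (R x) (H x) θ₀ δ₀ U ∧
          DirSupSq310 (𝔬 x) (𝔡 x) (R x) (H x) U ∧ Identities310₂ (𝔬 x) (𝔡 x) (𝔩 x) (R x) (H x) U) :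
    B9.Thm310Printed c35 geo9Y bg
      (fun x => W310OfOps (𝔬 x) (rd x)
        (Conv3107 (𝔬 x) (R x) (H x) (const37 (exp261 (@geo9Y d ℓ hd hL b₀ b₁ Mstar) δ₀ α) δ₀ α ρ B₀ N N' Cℓ K)
          ((1 - 2 * α) * δ₀))) :=
  thm310Printed_exp261_of_rowSum261₂ 𝔬 𝔡 𝔩 rd R H κ α ρ N N' NF Cℓ K θ₀ B₀ δ₀ a₁ M₁ hc hα hα2 hN hN' hNF hCℓ hK hθ₀ hB₀
    hδ₀ ha₁ hM₁ hst hκ hrd hloc rowSum261_geo9Y h36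

end FacesY

/-! ## §2 Rows 18 ∕ 19, G side: Theorem 3.10 at the literal all-blocks pin over `geo9Y`, over the direction letters -/

section StageY

variable {d ℓ : ℕ} {hd : 1 ≤ d + 1} {hL : Odd (ℓ + 1) ∧ 1 < ℓ + 1} {b₀ b₁ : ℝ} {Mstar : ℕ}
variable [∀ x : MemberY d ℓ hd hL b₀ b₁ Mstar, Fintype (geo9Y x).Site]
  [∀ x : MemberY d ℓ hd hL b₀ b₁ Mstar, DecidableEq (geo9Y x).Site]
variable {c35 : ℝ} {bg : MemberY d ℓ hd hL b₀ b₁ Mstar → B9.Backgrounds}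

/-- ★★ **(v2 OVER THE DIRECTION LETTERS, R1′-A: `h36 ∋ DirSupSq310 ∧ Identities310₂`; inside `thm310Printed_exp261_geo9Y₂` + `thm310Printed_allPin_completePairM_dir`; everything else VERBATIM `B9RWSumsCompleteGeo9YPairM.thm310_complete_geo9Y_pairM`.)** ★★ **THEOREM 3.10 AT THE LITERAL ALL-BLOCKS PIN OVER def-Y's MEMBERS, FROM OPERATOR-LEVEL INPUTS ONLY, THE (3.43)–(3.46) CO-READINGS SITED ON THE NEIGHBOURHOOD OF RADIUS 2** (the `Nbr` form of `B9RWSumsCompleteGeo9YRel.thm310_complete_geo9Y_rel`, on `B9RWSumsAllBlocksNbr.thm310Printed_allPin_completeNbr`; `geo9Y_dist_triangle`, `geo9Y_dist_symm`, `len_le_of_dist_le_two_geo9Y` by name).  With `C := const37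
(exp261 geo9Y δ₀ α) δ₀ α ρ B₀ N N′ C_ℓ K_c`, `δ := (1 − 2α)δ₀` and the pin `W310OfOps (𝔬 x) (rd x) (ConvAll3107 (𝔬 x) 1 (H x) C δ (K x)
B₁ δ₁ Bβ Bε Bεβ)` (p. 416: *"From (3.108) it follows that the expansion (3.107) is convergent in all norms in the inequalities
(3.42)–(3.47). This implies Theorem 3.3."* READ as Theorem 3.3's typed blocks for `K x`): the leaf `B9.Thm310Printed` holds, given
— the static data (`StaticOK310`, `Sizes310.Bounded`, `WalkReading310.OK`, `Locality310`); Corollary 3.6's blocks for the G_□, (3.89)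
and the structure (3.105) (`h36`), the Hölder ∕ probe-factor ∕ Laplacian ∕ input ∕ two-sided L² legs (`h36H`) at
(B₀, δ₀), all POSITED for M ≧ M₁, 0 < α₀, O(1)Mα₀ ≦ a₁, (3.35); the co-readings of `K x`; the transpose letters; the support
counts; the signs; the relations of (B₁, δ₁, Bβ, Bε, Bεβ) to the derived constants.  [4] Lemma 2.1, 1 ≦ L ≦ ℓ + 1, η > 0 and the
symmetry of d come from the record (`lemma21Pack_geo9Y`, `geo9Y_dist_symm`), the sup-block leaf from `thm310Printed_exp261_geo9Y`,
the rest is `B9RWSumsAllBlocksNbr.thm310Printed_allPin_completeNbr`.  Nothing of print asserted; NOT a node discharge.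
[cite: Balaban1985BackgroundPropagators, Thm 3.10 (3.105)–(3.108) pp.413–416 + Thm 3.3 p.399 + Cor. 3.6 p.408 + (3.42)–(3.47) pp.397–398; Balaban1984PropagatorsII, Lemma 2.1 (2.59)–(2.61) pp.233–234] -/
theorem thm310_complete_geo9Y_pairM_dir {X Y ι A PX PY Q : MemberY d ℓ hd hL b₀ b₁ Mstar → Type} [∀ x, Fintype (X x)]
    [∀ x, DecidableEq (X x)] [∀ x, Fintype (Y x)] [∀ x, DecidableEq (Y x)] [∀ x, Fintype (ι x)] [∀ x, Fintype (A x)]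
    [∀ x, Fintype (PX x)] [∀ x, DecidableEq (PX x)] [∀ x, Fintype (PY x)] [∀ x, DecidableEq (PY x)] [∀ x, Fintype (Q x)]
    (𝔬 : ∀ x : MemberY d ℓ hd hL b₀ b₁ Mstar, Ops310 (geo9Y x) (bg x) (X x) (Y x) (ι x) (A x))
    (rd : ∀ x : MemberY d ℓ hd hL b₀ b₁ Mstar, WalkReading310 (geo9Y x) (bg x) (X x) (ι x) (A x))
    (H : MemberY d ℓ hd hL b₀ b₁ Mstar → Prop)
    (𝔭 : ∀ x : MemberY d ℓ hd hL b₀ b₁ Mstar, HolderProbes (geo9Y x) (bg x) (X x) (Y x) (PX x) (PY x))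
    (𝔡 : ∀ x : MemberY d ℓ hd hL b₀ b₁ Mstar, DirOps310 (𝔬 x) (Q x))
    (𝔩 : ∀ x : MemberY d ℓ hd hL b₀ b₁ Mstar, DirLetters310 (𝔬 x) (Q x))
    (bHX : ∀ x : MemberY d ℓ hd hL b₀ b₁ Mstar, ℝ → BlockNorm (toB6 (geo9Y x) 1 (H x)) (X x → ℝ))
    (K : ∀ x : MemberY d ℓ hd hL b₀ b₁ Mstar, B9.KernelFamily (geo9Y x) (bg x))
    (ev : ∀ x : MemberY d ℓ hd hL b₀ b₁ Mstar, (geo9Y x).Loc → X x → ℝ)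
    (evY : ∀ x : MemberY d ℓ hd hL b₀ b₁ Mstar, (geo9Y x).Loc → Y x → ℝ)
    (Rel : ∀ x : MemberY d ℓ hd hL b₀ b₁ Mstar, (geo9Y x).Site → (geo9Y x).Site → Prop) [∀ x, DecidableRel (Rel x)] (m : ℕ)
    (Cev : ℝ) (mN : ℕ)
    (hRlen : ∀ x (a a' : (geo9Y x).Site), Rel x a a' → (geo9Y x).len a = (geo9Y x).len a')
    (hRd₁ : ∀ x (a a' b : (geo9Y x).Site), Rel x a a' → (geo9Y x).dist a b = (geo9Y x).dist a' b)
    (hRd₂ : ∀ x (a b b' : (geo9Y x).Site), Rel x b b' → (geo9Y x).dist a b = (geo9Y x).dist a b')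
    (hmult : ∀ x (y' : (geo9Y x).Site), (Finset.univ.filter (fun y'' => Rel x y'' y')).card ≤ m)
    (hnbr : ∀ (x : MemberY d ℓ hd hL b₀ b₁ Mstar) (y : (geo9Y x).Site), (nbr (geo9Y x) 2 y).card ≤ mN) (hCev : 0 ≤ Cev)
    (κ : MemberY d ℓ hd hL b₀ b₁ Mstar → Sizes310)
    (SH S3 SI SM : ∀ x : MemberY d ℓ hd hL b₀ b₁ Mstar, ι x → Finset (geo9Y x).Site)
    (Bl θH BI θI : ℝ → ℝ) (BI2 : ℝ → ℝ → ℝ)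
    (α ρ N N' NF Cℓ Kc θ₀ B₀ δ₀ a₁ M₁ αF NH N3 B3 θ3 NQ NI NM BM θM : ℝ) {B₁ δ₁ : ℝ} {Bβ Bε : ℝ → ℝ} {Bεβ : ℝ → ℝ → ℝ}
    (hc : 0 < c35) (hα : 0 < α) (hα2 : α < 1 / 2) (hN : 0 ≤ N) (hN' : 0 ≤ N') (hNF : 0 ≤ NF) (hCℓ : 1 ≤ Cℓ) (hK : 0 ≤ Kc)
    (hθ₀ : 0 ≤ θ₀) (hB₀ : 0 < B₀) (hδ₀ : 0 < δ₀) (ha₁ : 0 < a₁) (hM₁ : 0 < M₁) (hαF : 0 < αF) (hαF2 : αF ≤ 1 / 2)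
    (hNH : 0 ≤ NH) (hN3 : 0 ≤ N3) (hB3 : 0 ≤ B3) (hθ3 : 0 ≤ θ3) (hNI : 0 ≤ NI) (hNM : 0 ≤ NM) (hBM : 0 ≤ BM) (hθM : 0 ≤ θM)
    (hst : ∀ x, StaticOK310 (𝔬 x) ρ N N' NF Cℓ (κ x)) (hκ : ∀ x, (κ x).Bounded Kc)
    (hrd : ∀ x, (rd x).OK (𝔬 x).blk) (hloc : ∀ x, Locality310 (𝔬 x) (rd x))
    (h36 : ∀ x, M₁ ≤ (geo9Y x).M → ∀ α₀ : ℝ, 0 < α₀ → c35 * (geo9Y x).M * α₀ ≤ a₁ →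
      ∀ U : (bg x).Cfg, (bg x).Reg335 c35 α₀ U →
        Local342G (𝔬 x) 1 (H x) B₀ δ₀ U ∧ B9Thm310Whole.Factors389 (𝔬 x) 1 (H x) θ₀ δ₀ U ∧ DirSupSq310 (𝔬 x) (𝔡 x) 1 (H x) U ∧
          Identities310₂ (𝔬 x) (𝔡 x) (𝔩 x) 1 (H x) U)
    (h36H : ∀ x, M₁ ≤ (geo9Y x).M → ∀ α₀ : ℝ, 0 < α₀ → c35 * (geo9Y x).M * α₀ ≤ a₁ →
      ∀ U : (bg x).Cfg, (bg x).Reg335 c35 α₀ U →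
        HolderLegs310 (𝔬 x) (𝔭 x) 1 (H x) (SH x) Bl δ₀ U ∧ FactorsHolder310 (𝔬 x) (𝔭 x) 1 (H x) θH δ₀ U ∧
          (L2SecondLegs310 (𝔬 x) (𝔡 x) 1 (H x) (S3 x) B3 δ₀ U ∧ FactorsL2Second310 (𝔬 x) (𝔡 x) 1 (H x) θ3 δ₀ U ∧
            DirTranspose310 (𝔬 x) (𝔡 x) U) ∧
            (InputLegsPair310 (𝔬 x) (𝔡 x) (𝔭 x) 1 (H x) (bHX x) (SI x) BI BI2 δ₀ U ∧
              FactorsInputPair310 (𝔬 x) (𝔡 x) 1 (H x) (bHX x) θI δ₀ U ∧ DirSupHolder310 (𝔬 x) (𝔡 x) (𝔭 x) 1 (H x) U) ∧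
              (L2MixedLegs310 (𝔬 x) (𝔡 x) 1 (H x) (SM x) BM δ₀ U ∧ FactorsL2Mixed310 (𝔬 x) (𝔡 x) 1 (H x) θM δ₀ U ∧
                DirSup310 (𝔬 x) (𝔡 x) 1 (H x) U))
    (hco0 : ∀ x U, CoRealizesRel (K x) 0 U (Rel x) (𝔬 x).blk (𝔬 x).blk (ev x) ((𝔬 x).G U))
    (hco1 : ∀ x U, CoRealizesRel (K x) 1 U (Rel x) (𝔬 x).blkY (𝔬 x).blk (ev x) ((𝔬 x).D U ∘ₗ (𝔬 x).G U))
    (hco2 : ∀ x U, CoRealizesRel (K x) 2 U (Rel x) (𝔬 x).blk (𝔬 x).blkY (evY x) ((𝔬 x).G U ∘ₗ (𝔬 x).Dstar U))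
    (hco3 : ∀ x U, CoRealizesRel (K x) 3 U (Rel x) (𝔬 x).blk (𝔬 x).blk (ev x) ((𝔬 x).Lap U ∘ₗ (𝔬 x).G U))
    (hgl0 : ∀ x U, GlobReads (K x) 0 U (𝔬 x).blk (𝔬 x).blk (ev x) ((𝔬 x).G U))
    (hgl1 : ∀ x U, GlobReads (K x) 1 U (𝔬 x).blkY (𝔬 x).blk (ev x) ((𝔬 x).D U ∘ₗ (𝔬 x).G U))
    (hgl2 : ∀ x U, GlobReads (K x) 2 U (𝔬 x).blk (𝔬 x).blkY (evY x) ((𝔬 x).G U ∘ₗ (𝔬 x).Dstar U))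
    (hgl3 : ∀ x U, GlobReads (K x) 3 U (𝔬 x).blk (𝔬 x).blk (ev x) ((𝔬 x).Lap U ∘ₗ (𝔬 x).G U))
    (hl0 : ∀ x U, L2ReadsNbr (R := 1) (H := H x) (K x) 0 U (Rel x) 2 Cev (𝔬 x).blk (𝔬 x).blk (ev x) ((𝔬 x).G U))
    (hl1 : ∀ x U, L2ReadsNbr (R := 1) (H := H x) (K x) 1 U (Rel x) 2 Cev (𝔬 x).blkY (𝔬 x).blk (ev x) ((𝔬 x).D U ∘ₗ (𝔬 x).G U))
    (hl2 : ∀ x U, L2ReadsNbr (R := 1) (H := H x) (K x) 2 U (Rel x) 2 Cev (𝔬 x).blk (𝔬 x).blkY (evY x) ((𝔬 x).G U ∘ₗ (𝔬 x).Dstar U))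
    (hl3 : ∀ x U, L2ReadsNbr (R := 1) (H := H x) (K x) 3 U (Rel x) 2 Cev ((𝔬 x).blk ∘ Prod.fst) (𝔬 x).blk (ev x)
      (familyOp fun p : Q x × Q x => (𝔡 x).Dd U p.1 ∘ₗ ((𝔬 x).G U ∘ₗ (𝔡 x).Dsd U p.2)))
    (hl4 : ∀ x U, L2ReadsNbr (R := 1) (H := H x) (K x) 4 U (Rel x) 2 Cev ((𝔬 x).blk ∘ Prod.fst) (𝔬 x).blk (ev x)
      (familyOp fun p : Q x × Q x => ((𝔡 x).Dd U p.1 ∘ₗ (𝔡 x).Dd U p.2) ∘ₗ (𝔬 x).G U))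
    (hl5 : ∀ x U, L2ReadsNbr (R := 1) (H := H x) (K x) 5 U (Rel x) 2 Cev ((𝔬 x).blk ∘ Prod.fst) (𝔬 x).blk (ev x)
      (familyOp fun p : Q x × Q x => (𝔬 x).G U ∘ₗ ((𝔡 x).Dsd U p.1 ∘ₗ (𝔡 x).Dsd U p.2)))
    (hH1 : ∀ x U, H1ReadsNbr (K x) U (𝔭 x) (Rel x) 2 (𝔬 x).blk (𝔬 x).blkY (ev x) (evY x) ((𝔬 x).D U ∘ₗ (𝔬 x).G U)
      ((𝔬 x).G U ∘ₗ (𝔬 x).Dstar U))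
    (hIR : ∀ x U, InputReadsFam (K x) U (bHX x) 2 ((𝔬 x).blk ∘ Prod.fst) ((𝔭 x).blkPX ∘ Prod.fst)
      (fun β => sliceProbe ((𝔭 x).ΦX U β)) (ev x)
      (familyOp fun p : Q x × Q x => (𝔡 x).Dd U p.1 ∘ₗ ((𝔬 x).G U ∘ₗ (𝔡 x).Dsd U p.2)))
    (hsym : ∀ x, M₁ ≤ (geo9Y x).M → ∀ α₀ : ℝ, 0 < α₀ → c35 * (geo9Y x).M * α₀ ≤ a₁ →
      ∀ U : (bg x).Cfg, (bg x).Reg335 c35 α₀ U → IsTransposePair ((𝔬 x).G U) ((𝔬 x).G U))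
    (htr : ∀ x, M₁ ≤ (geo9Y x).M → ∀ α₀ : ℝ, 0 < α₀ → c35 * (geo9Y x).M * α₀ ≤ a₁ →
      ∀ U : (bg x).Cfg, (bg x).Reg335 c35 α₀ U → IsTransposePair ((𝔬 x).D U ∘ₗ (𝔬 x).G U) ((𝔬 x).G U ∘ₗ (𝔬 x).Dstar U))
    (hcntH : ∀ x (a : (geo9Y x).Site), (∑ q, if a ∈ SH x q then (1 : ℝ) else 0) ≤ NH)
    (hcnt3 : ∀ x (a : (geo9Y x).Site), (∑ q, if a ∈ S3 x q then (1 : ℝ) else 0) ≤ N3)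
    (hNQ : ∀ x, (Fintype.card (Q x) : ℝ) ≤ NQ)
    (hcntI : ∀ x (a : (geo9Y x).Site), (∑ q, if a ∈ SI x q then (1 : ℝ) else 0) ≤ NI)
    (hcntM : ∀ x (a : (geo9Y x).Site), (∑ q, if a ∈ SM x q then (1 : ℝ) else 0) ≤ NM)
    (hBl : ∀ β, 0 ≤ β → β < 1 → 0 ≤ Bl β) (hθH : ∀ β, 0 ≤ β → β < 1 → 0 ≤ θH β)
    (hBI : ∀ ε, 0 < ε → ε ≤ 1 → 0 ≤ BI ε) (hBI2 : ∀ ε β, 0 < ε → ε ≤ 1 → 0 ≤ β → β < 1 → 0 ≤ BI2 ε β)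
    (hθI : ∀ ε, 0 < ε → 0 ≤ θI ε)
    -- the relations of the all-blocks constants (B₁, δ₁, Bβ, Bε, Bεβ) to the definite derived ones
    (hCB : (m : ℝ) * const37 (exp261 (@geo9Y d ℓ hd hL b₀ b₁ Mstar) δ₀ α) δ₀ α ρ B₀ N N' Cℓ Kc ≤ B₁)
    (hCL : (mN : ℝ) * m * Cev * (((ℓ + 1 : ℕ) : ℝ)) ^ 2 * Real.exp (2 * δ₁) * 
      (const37 (exp261 (@geo9Y d ℓ hd hL b₀ b₁ Mstar) δ₀ α) δ₀ α ρ B₀ N N' Cℓ Kc * ((ℓ + 1 : ℕ) : ℝ)) ≤ B₁)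
    (hδ₁nn : 0 ≤ δ₁) (hδ₁ : δ₁ ≤ (1 - 2 * αF) * ((1 - 2 * α) * δ₀))
    (hCg : const37 (exp261 (@geo9Y d ℓ hd hL b₀ b₁ Mstar) δ₀ α) δ₀ α ρ B₀ N N' Cℓ Kc *
      B6.c1 (exp261 (@geo9Y d ℓ hd hL b₀ b₁ Mstar) ((1 - 2 * α) * δ₀) (1 - αF)) ((1 - 2 * α) * δ₀) (1 - αF) *
        ((ℓ + 1 : ℕ) : ℝ) ^ (4 : ℝ) ≤ B₁)
    (hB35 : (mN : ℝ) * m * Cev * (((ℓ + 1 : ℕ) : ℝ)) ^ 2 * Real.exp (2 * δ₁) * 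
      (NQ * secondConst (exp261 (@geo9Y d ℓ hd hL b₀ b₁ Mstar) δ₀ α) δ₀ α N3 B3 NF θ3
        (const37 (exp261 (@geo9Y d ℓ hd hL b₀ b₁ Mstar) δ₀ α) δ₀ α ρ B₀ N N' Cℓ Kc) ((ℓ + 1 : ℕ) : ℝ)) ≤ B₁)
    (hB3M : (mN : ℝ) * m * Cev * (((ℓ + 1 : ℕ) : ℝ)) ^ 2 * Real.exp (2 * δ₁) *
      (NQ * mixedConst (exp261 (@geo9Y d ℓ hd hL b₀ b₁ Mstar) δ₀ α) δ₀ α NM BM NF θM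
        (const37 (exp261 (@geo9Y d ℓ hd hL b₀ b₁ Mstar) δ₀ α) δ₀ α ρ B₀ N N' Cℓ Kc) ((ℓ + 1 : ℕ) : ℝ)) ≤ B₁)
    (hBβ : ∀ β, 0 ≤ β → β < 1 →
      (m : ℝ) * ((ℓ + 1 : ℕ) : ℝ) * Real.exp (2 * δ₁) * holderConst (exp261 (@geo9Y d ℓ hd hL b₀ b₁ Mstar) δ₀ α) δ₀ α NH NF
        (const37 (exp261 (@geo9Y d ℓ hd hL b₀ b₁ Mstar) δ₀ α) δ₀ α ρ B₀ N N' Cℓ Kc) (Bl β) (θH β) ≤ Bβ β)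
    (hBε : ∀ ε, 0 < ε → ε ≤ 1 →
      Real.exp (2 * δ₁) * inputConst44 (exp261 (@geo9Y d ℓ hd hL b₀ b₁ Mstar) δ₀ α) δ₀ α NI NF
        (const37 (exp261 (@geo9Y d ℓ hd hL b₀ b₁ Mstar) δ₀ α) δ₀ α ρ B₀ N N' Cℓ Kc) ((ℓ + 1 : ℕ) : ℝ) (BI ε) (θI ε) ≤ Bε ε)
    (hBεβ : ∀ ε β, 0 < ε → ε ≤ 1 → 0 ≤ β → β < 1 →
      ((ℓ + 1 : ℕ) : ℝ) * Real.exp (2 * δ₁) * inputConst45 (exp261 (@geo9Y d ℓ hd hL b₀ b₁ Mstar) δ₀ α) δ₀ α NI NF ((ℓ + 1 : ℕ) : ℝ)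
        (holderConst (exp261 (@geo9Y d ℓ hd hL b₀ b₁ Mstar) δ₀ α) δ₀ α NH NF
          (const37 (exp261 (@geo9Y d ℓ hd hL b₀ b₁ Mstar) δ₀ α) δ₀ α ρ B₀ N N' Cℓ Kc) (Bl β) (θH β))
        (BI2 ε β) (θI (β + ε)) ≤ Bεβ ε β) :
    B9.Thm310Printed c35 geo9Y bg
      (fun x => W310OfOps (𝔬 x) (rd x)
        (ConvAll3107 (𝔬 x) 1 (H x) (const37 (exp261 (@geo9Y d ℓ hd hL b₀ b₁ Mstar) δ₀ α) δ₀ α ρ B₀ N N' Cℓ Kc)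
          ((1 - 2 * α) * δ₀) (K x) B₁ δ₁ Bβ Bε Bεβ)) := by
  obtain ⟨Mth, h261, hfacts, -⟩ :=
    lemma21Pack_geo9Y (d := d) (ℓ := ℓ) (hd := hd) (hL := hL) (b₀ := b₀) (b₁ := b₁) (Mstar := Mstar) H hα hα2 hδ₀ hαF
      (by linarith)
  have h310 := thm310Printed_exp261_geo9Y₂ (bg := bg) 𝔬 𝔡 𝔩 rd (fun _ => 1) H κ α ρ N N' NF Cℓ Kc θ₀ B₀ δ₀ a₁ M₁ hc hα hα2.le hN
    hN' hNF hCℓ hK hθ₀ hB₀ hδ₀ ha₁ hM₁ hst hκ hrd hloc h36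
  have hC : 0 ≤ const37 (exp261 (@geo9Y d ℓ hd hL b₀ b₁ Mstar) δ₀ α) δ₀ α ρ B₀ N N' Cℓ Kc :=
    const37_nonneg_of_signs _ hB₀.le hN hN' (zero_le_one.trans hCℓ) hK
  have hδs : 0 < (1 - 2 * α) * δ₀ := mul_pos (by linarith) hδ₀
  exact thm310Printed_allPin_completePairM_dir (geo := geo9Y) (R := fun _ => (1 : ℝ)) 𝔭 𝔡 𝔩 bHX K ev evY Rel m 2 Cev (((ℓ + 1 : ℕ) : ℝ)) mN κ SH Bl θH
    (exp261 (@geo9Y d ℓ hd hL b₀ b₁ Mstar) δ₀ α) δ₀ α ρ N N' NF Cℓ θ₀ NH a₁ M₁ Mth S3 N3 B3 θ3 NQ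
    SI NI BI θI BI2 SM NM BM θM h310 hRlen hRd₁ hRd₂ hmult hnbr one_le_L_nat len_le_of_dist_le_two_geo9Y
    geo9Y_dist_triangle hCev hco0 hco1 hco2 hco3 hgl0 hgl1 hgl2 hgl3
    hl0 hl1 hl2 hl3 hl4 hl5 hH1 hIR hsym htr hfacts geo9Y_dist_symm hC hCB hCL hδ₁nn (by nlinarith) hδ₁
    (mul_nonneg hαF.le hδs.le) (by nlinarith) hCg hc ha₁ hα.le hα2.le hNF hθ₀ hNH hδs.le le_rfl hδ₀.le hN3 hB3 hθ3 hNI hNM hBM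
    hθM hB35 hB3M hst hcntH hcnt3 hNQ hcntI hcntM hBl hθH hBI hBI2 hθI hBβ hBε hBεβ h261
    (fun x hM α₀ hα₀ ha U hU => ⟨(h36 x hM α₀ hα₀ ha U hU).2.1, (h36 x hM α₀ hα₀ ha U hU).2.2.2, (h36H x hM α₀ hα₀ ha U hU).1,
      (h36H x hM α₀ hα₀ ha U hU).2.1⟩)
    (fun x hM α₀ hα₀ ha U hU => (h36H x hM α₀ hα₀ ha U hU).2.2.1)
    (fun x hM α₀ hα₀ ha U hU => (h36H x hM α₀ hα₀ ha U hU).2.2.2.1)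
    (fun x hM α₀ hα₀ ha U hU => (h36H x hM α₀ hα₀ ha U hU).2.2.2.2)

/-! ## §3 Rows 13 ∕ 18 ∕ 19 as ONE face, both sides over the direction letters -/

/-- `lowerB_{G′} ≤ B1Y` (twin of the sibling's private lemma). [folklore] -/
private theorem lowerB_le_B1Y_left'' (p q : PinPrims) (dp dFp dq dFq : ℕ) (L₀ : ℝ) :
    p.lowerB dp dFp p.N' L₀ ≤ B1Y p q dp dFp dq dFq L₀ :=
  (le_max_left _ _).trans (le_max_right _ _)

/-- `lowerB_G ≤ B1Y` (twin of the sibling's private lemma). [folklore] -/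
private theorem lowerB_le_B1Y_right'' (p q : PinPrims) (dp dFp dq dFq : ℕ) (L₀ : ℝ) :
    q.lowerB dq dFq q.NF L₀ ≤ B1Y p q dp dFp dq dFq L₀ :=
  (le_max_right _ _).trans (le_max_right _ _)

/-- `C ≤ pinLowerB …`. [folklore] -/
private theorem le_pinLowerB₁'' (C cF lapC twoC L₀ : ℝ) : C ≤ pinLowerB C cF lapC twoC L₀ :=
  (le_max_left _ _).trans ((le_max_left _ _).trans ((le_max_left _ _).trans (le_max_left _ _)))

/-- `C·L₀ ≤ pinLowerB …`. [folklore] -/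
private theorem le_pinLowerB₂'' (C cF lapC twoC L₀ : ℝ) : C * L₀ ≤ pinLowerB C cF lapC twoC L₀ :=
  (le_max_right _ _).trans ((le_max_left _ _).trans ((le_max_left _ _).trans (le_max_left _ _)))

/-- `C·c_F·L₀⁴ ≤ pinLowerB …`. [folklore] -/
private theorem le_pinLowerB₃'' (C cF lapC twoC L₀ : ℝ) : C * cF * L₀ ^ (4 : ℝ) ≤ pinLowerB C cF lapC twoC L₀ :=
  (le_max_right _ _).trans ((le_max_left _ _).trans (le_max_left _ _))

/-- `√(C·lapC)·L₀ ≤ pinLowerB …`. [folklore] -/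
private theorem le_pinLowerB₄'' (C cF lapC twoC L₀ : ℝ) : Real.sqrt (C * lapC) * L₀ ≤ pinLowerB C cF lapC twoC L₀ :=
  (le_max_right _ _).trans (le_max_left _ _)

/-! ## §2 ★★★ Rows 13 ∕ 18 ∕ 19 as ONE face at the definite `Pair` E-letters -/

set_option maxHeartbeats 400000 in
-- build stability: the v3.1 twin needed the same guard in the tree (ops-buildfix-2, p516056)
/-- ★★★ **(v3, BOTH SIDES OVER THE DIRECTION LETTERS — R1′ (G′: `h36 ∋ DirSupSq37 ∧ Identities₂`, `HolderV37Dir`, `Factors…37Dir`, `LocalityDir`, E-letter `E37YPairMDir`) AND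
R1′-A (G: `h36A ∋ DirSupSq310 ∧ Identities310₂`, new family `𝔩A : DirLetters310`); everything else VERBATIM `B9RWSumsDefinitePinsPairM.rows131819_definite_geo9Y_pairM`.)
ROWS 13 ∕ 18 ∕ 19 OF THE N06 CENSUS AT def-Y's MEMBERS WITH DEFINITE EXPANSION DATA, NEIGHBOURHOOD-SITED CO-READINGS, AND THE
PRINTED SECOND-ORDER L² MEMBERS AS DIRECTION-PAIR FAMILIES** — the `Pair` form of `B9RWSumsDefinitePinsNbr.rows131819_definite_geo9Y_nbr`:
Theorem 3.7 ∧ Corollary 3.8 at `E37YPair m mN Cev NQ p q p3 q3`, Theorem 3.10 at `E310YPair …` and the summation leaf for the pair, from the sign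
records `p q` (sibling's) and `p3 q3` (second-order legs and factors), the direction count bound `NQ`, ONE block equivalence `Rel x` with class
multiplicity and saturation, the neighbourhood count, the evaluation constant, the direction letters `𝔡 𝔡A`, and the OPERATOR-LEVEL inputs of
both sides (the Laplacian legs replaced by `L2SecondLegs… ∧ FactorsL2Second… ∧ DirTranspose…`; `hl4 hl5 hlA4 hlA5` read the `familyOp`
packages of ∇∇G′, G′∇\*∇\*, ∇∇G, G∇\*∇\*, `hl3 hlA3` the mixed members ∇G′∇\*, ∇G∇\* on the PAIR FAMILY `Dd ∘ G ∘ Dsd` (v4), `hIR hIRA` the (3.44)∕(3.45)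
members on the same family through `InputReadsFam` with sliced X-probes — def-Y's K-index order).  Inside: `thm37_cor38_complete_geo9Y_pairM` ∕
`thm310_complete_geo9Y_pairM` at B₁ := `nbrScale … · B1PairM …`,
δ₁ := `delta1Y p q`, the three Hölder∕input families scaled by `nbrScale …`, and `rwSumsYieldIneqs_allPins`.  Nothing of print asserted; NOT a node
discharge.
[cite: Balaban1985BackgroundPropagators, Thm 3.7 p.409 + Cor. 3.8 p.410 + Thm 3.10 pp.415–416 + Thm 3.7 ⇒ Thm 3.1 p.410 + Thm 3.10 ⇒ Thm 3.3 p.416 + Cor. 3.6 p.408; Balaban1984PropagatorsII, (2.51)–(2.52) p.232 + Lemma 2.1 pp.233–234] -/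
theorem rows131819_definite_geo9Y_pairM_dir₂ {X Y ι PX PY Q XA YA ιA AA PXA PYA QA : MemberY d ℓ hd hL b₀ b₁ Mstar → Type}
    [∀ x, Fintype (X x)] [∀ x, DecidableEq (X x)] [∀ x, Fintype (Y x)] [∀ x, DecidableEq (Y x)] [∀ x, Fintype (ι x)]
    [∀ x, Fintype (PX x)] [∀ x, DecidableEq (PX x)] [∀ x, Fintype (PY x)] [∀ x, DecidableEq (PY x)]
    [∀ x, Fintype (XA x)] [∀ x, DecidableEq (XA x)] [∀ x, Fintype (YA x)] [∀ x, DecidableEq (YA x)] [∀ x, Fintype (ιA x)]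
    [∀ x, Fintype (AA x)] [∀ x, Fintype (PXA x)] [∀ x, DecidableEq (PXA x)] [∀ x, Fintype (PYA x)] [∀ x, DecidableEq (PYA x)]
    [∀ x, Fintype (Q x)] [∀ x, Fintype (QA x)]
    (p q : PinPrims) (hp : p.OK) (hq : q.OK) (p3 q3 : PairPrims) (hp3 : p3.OK) (hq3 : q3.OK) (pM qM : MixedPrims) (hpM : pM.OK)
    (hqM : qM.OK) (NQ : ℝ) (hNQ0 : 0 ≤ NQ)
    (hc : 0 < c35) (H : MemberY d ℓ hd hL b₀ b₁ Mstar → Prop)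
    -- the block equivalence of the instance («same carrier block»), its multiplicity and saturation
    (Rel : ∀ x : MemberY d ℓ hd hL b₀ b₁ Mstar, (geo9Y x).Site → (geo9Y x).Site → Prop) [∀ x, DecidableRel (Rel x)] (m mN : ℕ)
    (Cev : ℝ) (hCev : 0 ≤ Cev)
    (hRlen : ∀ x (a a' : (geo9Y x).Site), Rel x a a' → (geo9Y x).len a = (geo9Y x).len a')
    (hRd₁ : ∀ x (a a' b : (geo9Y x).Site), Rel x a a' → (geo9Y x).dist a b = (geo9Y x).dist a' b)
    (hRd₂ : ∀ x (a b b' : (geo9Y x).Site), Rel x b b' → (geo9Y x).dist a b = (geo9Y x).dist a b')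
    (hmult : ∀ x (y' : (geo9Y x).Site), (Finset.univ.filter (fun y'' => Rel x y'' y')).card ≤ m)
    (hnbr : ∀ (x : MemberY d ℓ hd hL b₀ b₁ Mstar) (y : (geo9Y x).Site), (nbr (geo9Y x) 2 y).card ≤ mN)
    -- the G′ side (Theorem 3.7 ∕ Corollary 3.8)
    (𝔬 : ∀ x : MemberY d ℓ hd hL b₀ b₁ Mstar, Ops (geo9Y x) (bg x) (X x) (Y x) (ι x))
    (rd : ∀ x : MemberY d ℓ hd hL b₀ b₁ Mstar, WalkReading (geo9Y x) (bg x) (X x) (ι x))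
    (𝔭 : ∀ x : MemberY d ℓ hd hL b₀ b₁ Mstar, HolderProbes (geo9Y x) (bg x) (X x) (Y x) (PX x) (PY x))
    (𝔡 : ∀ x : MemberY d ℓ hd hL b₀ b₁ Mstar, DirOps37 (𝔬 x) (Q x)) (𝔩 : ∀ x : MemberY d ℓ hd hL b₀ b₁ Mstar, DirLetters37 (𝔬 x) (Q x))
    (bHX : ∀ x : MemberY d ℓ hd hL b₀ b₁ Mstar, ℝ → BlockNorm (toB6 (geo9Y x) 1 (H x)) (X x → ℝ))
    (K : ∀ x : MemberY d ℓ hd hL b₀ b₁ Mstar, B9.KernelFamily (geo9Y x) (bg x))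
    (ev : ∀ x : MemberY d ℓ hd hL b₀ b₁ Mstar, (geo9Y x).Loc → X x → ℝ)
    (evY : ∀ x : MemberY d ℓ hd hL b₀ b₁ Mstar, (geo9Y x).Loc → Y x → ℝ)
    (κ : MemberY d ℓ hd hL b₀ b₁ Mstar → Sizes) (SH S3 SI SM : ∀ x : MemberY d ℓ hd hL b₀ b₁ Mstar, ι x → Finset (geo9Y x).Site)
    (hst : ∀ x, StaticOK (𝔬 x) p.ρ p.Nc p.N' p.Cℓ (κ x)) (hκ : ∀ x, (κ x).Bounded p.Kc p.θ₀ p.Cℓ (geo9Y x).M)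
    (hrd : ∀ x, (rd x).OK (𝔬 x).blk) (hloc : ∀ x, LocalityDir (𝔬 x) (𝔡 x) (𝔩 x) (rd x))
    (h36 : ∀ x, p.M₁ ≤ (geo9Y x).M → ∀ α₀ : ℝ, 0 < α₀ → c35 * (geo9Y x).M * α₀ ≤ p.a₁ →
      ∀ U : (bg x).Cfg, (bg x).Reg335 c35 α₀ U →
        Local342 (𝔬 x) 1 (H x) p.B₀ p.δ₀ U ∧ DirSupSq37 (𝔬 x) (𝔡 x) 1 (H x) U ∧ Identities₂ (𝔬 x) (𝔡 x) (𝔩 x) 1 (H x) U)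
    (h36H : ∀ x, p.M₁ ≤ (geo9Y x).M → ∀ α₀ : ℝ, 0 < α₀ → c35 * (geo9Y x).M * α₀ ≤ p.a₁ →
      ∀ U : (bg x).Cfg, (bg x).Reg335 c35 α₀ U →
        HolderLegs37 (𝔬 x) (𝔭 x) 1 (H x) (SH x) p.Bl p.δ₀ U ∧ HolderV37Dir (𝔬 x) (𝔡 x) (𝔩 x) (𝔭 x) 1 (H x) p.Bt p.δ₀ U ∧
          (L2SecondLegs37 (𝔬 x) (𝔡 x) 1 (H x) (S3 x) p3.B3 p.δ₀ U ∧ FactorsL2Second37Dir (𝔬 x) (𝔡 x) (𝔩 x) 1 (H x) p3.θ3 p.δ₀ U ∧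
            DirTranspose37 (𝔬 x) (𝔡 x) U) ∧
            (InputLegsPair37 (𝔬 x) (𝔡 x) (𝔭 x) 1 (H x) (bHX x) (SI x) p.BI p.BI2 p.δ₀ U ∧
              FactorsInputPair37Dir (𝔬 x) (𝔡 x) (𝔩 x) 1 (H x) (bHX x) p.θI p.δ₀ U ∧ DirSupHolder37 (𝔬 x) (𝔡 x) (𝔭 x) 1 (H x) U) ∧
              (L2MixedLegs37 (𝔬 x) (𝔡 x) 1 (H x) (SM x) pM.BM p.δ₀ U ∧ FactorsL2Mixed37Dir (𝔬 x) (𝔡 x) (𝔩 x) 1 (H x) pM.θM p.δ₀ U ∧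
                DirSup37 (𝔬 x) (𝔡 x) 1 (H x) U))
    (hco0 : ∀ x U, CoRealizesRel (K x) 0 U (Rel x) (𝔬 x).blk (𝔬 x).blk (ev x) ((𝔬 x).Gp U))
    (hco1 : ∀ x U, CoRealizesRel (K x) 1 U (Rel x) (𝔬 x).blkY (𝔬 x).blk (ev x) ((𝔬 x).D U ∘ₗ (𝔬 x).Gp U))
    (hco2 : ∀ x U, CoRealizesRel (K x) 2 U (Rel x) (𝔬 x).blk (𝔬 x).blkY (evY x) ((𝔬 x).Gp U ∘ₗ (𝔬 x).Dstar U))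
    (hco3 : ∀ x U, CoRealizesRel (K x) 3 U (Rel x) (𝔬 x).blk (𝔬 x).blk (ev x) ((𝔬 x).Lap U ∘ₗ (𝔬 x).Gp U))
    (hgl0 : ∀ x U, GlobReads (K x) 0 U (𝔬 x).blk (𝔬 x).blk (ev x) ((𝔬 x).Gp U))
    (hgl1 : ∀ x U, GlobReads (K x) 1 U (𝔬 x).blkY (𝔬 x).blk (ev x) ((𝔬 x).D U ∘ₗ (𝔬 x).Gp U))
    (hgl2 : ∀ x U, GlobReads (K x) 2 U (𝔬 x).blk (𝔬 x).blkY (evY x) ((𝔬 x).Gp U ∘ₗ (𝔬 x).Dstar U))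
    (hgl3 : ∀ x U, GlobReads (K x) 3 U (𝔬 x).blk (𝔬 x).blk (ev x) ((𝔬 x).Lap U ∘ₗ (𝔬 x).Gp U))
    (hl0 : ∀ x U, L2ReadsNbr (R := 1) (H := H x) (K x) 0 U (Rel x) 2 Cev (𝔬 x).blk (𝔬 x).blk (ev x) ((𝔬 x).Gp U))
    (hl1 : ∀ x U, L2ReadsNbr (R := 1) (H := H x) (K x) 1 U (Rel x) 2 Cev (𝔬 x).blkY (𝔬 x).blk (ev x) ((𝔬 x).D U ∘ₗ (𝔬 x).Gp U))
    (hl2 : ∀ x U, L2ReadsNbr (R := 1) (H := H x) (K x) 2 U (Rel x) 2 Cev (𝔬 x).blk (𝔬 x).blkY (evY x) ((𝔬 x).Gp U ∘ₗ (𝔬 x).Dstar U))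
    (hl3 : ∀ x U, L2ReadsNbr (R := 1) (H := H x) (K x) 3 U (Rel x) 2 Cev ((𝔬 x).blk ∘ Prod.fst) (𝔬 x).blk (ev x)
      (familyOp fun p : Q x × Q x => (𝔡 x).Dd U p.1 ∘ₗ ((𝔬 x).Gp U ∘ₗ (𝔡 x).Dsd U p.2)))
    (hl4 : ∀ x U, L2ReadsNbr (R := 1) (H := H x) (K x) 4 U (Rel x) 2 Cev ((𝔬 x).blk ∘ Prod.fst) (𝔬 x).blk (ev x)
      (familyOp fun p : Q x × Q x => ((𝔡 x).Dd U p.1 ∘ₗ (𝔡 x).Dd U p.2) ∘ₗ (𝔬 x).Gp U))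
    (hl5 : ∀ x U, L2ReadsNbr (R := 1) (H := H x) (K x) 5 U (Rel x) 2 Cev ((𝔬 x).blk ∘ Prod.fst) (𝔬 x).blk (ev x)
      (familyOp fun p : Q x × Q x => (𝔬 x).Gp U ∘ₗ ((𝔡 x).Dsd U p.1 ∘ₗ (𝔡 x).Dsd U p.2)))
    (hH1 : ∀ x U, H1ReadsNbr (K x) U (𝔭 x) (Rel x) 2 (𝔬 x).blk (𝔬 x).blkY (ev x) (evY x) ((𝔬 x).D U ∘ₗ (𝔬 x).Gp U)
      ((𝔬 x).Gp U ∘ₗ (𝔬 x).Dstar U))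
    (hIR : ∀ x U, InputReadsFam (K x) U (bHX x) 2 ((𝔬 x).blk ∘ Prod.fst) ((𝔭 x).blkPX ∘ Prod.fst)
      (fun β => sliceProbe ((𝔭 x).ΦX U β)) (ev x)
      (familyOp fun p : Q x × Q x => (𝔡 x).Dd U p.1 ∘ₗ ((𝔬 x).Gp U ∘ₗ (𝔡 x).Dsd U p.2)))
    (hsym : ∀ x, p.M₁ ≤ (geo9Y x).M → ∀ α₀ : ℝ, 0 < α₀ → c35 * (geo9Y x).M * α₀ ≤ p.a₁ →
      ∀ U : (bg x).Cfg, (bg x).Reg335 c35 α₀ U → IsTransposePair ((𝔬 x).Gp U) ((𝔬 x).Gp U))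
    (htr : ∀ x, p.M₁ ≤ (geo9Y x).M → ∀ α₀ : ℝ, 0 < α₀ → c35 * (geo9Y x).M * α₀ ≤ p.a₁ →
      ∀ U : (bg x).Cfg, (bg x).Reg335 c35 α₀ U → IsTransposePair ((𝔬 x).D U ∘ₗ (𝔬 x).Gp U) ((𝔬 x).Gp U ∘ₗ (𝔬 x).Dstar U))
    (hcntH : ∀ x (a : (geo9Y x).Site), (∑ c, if a ∈ SH x c then (1 : ℝ) else 0) ≤ p.NH)
    (hcnt3 : ∀ x (a : (geo9Y x).Site), (∑ c, if a ∈ S3 x c then (1 : ℝ) else 0) ≤ p3.N3)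
    (hNQ : ∀ x, (Fintype.card (Q x) : ℝ) ≤ NQ)
    (hcntI : ∀ x (a : (geo9Y x).Site), (∑ c, if a ∈ SI x c then (1 : ℝ) else 0) ≤ p.NI)
    (hcntM : ∀ x (a : (geo9Y x).Site), (∑ c, if a ∈ SM x c then (1 : ℝ) else 0) ≤ pM.NM)
    -- the G side (Theorem 3.10)
    (𝔬A : ∀ x : MemberY d ℓ hd hL b₀ b₁ Mstar, Ops310 (geo9Y x) (bg x) (XA x) (YA x) (ιA x) (AA x))
    (rdA : ∀ x : MemberY d ℓ hd hL b₀ b₁ Mstar, WalkReading310 (geo9Y x) (bg x) (XA x) (ιA x) (AA x))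
    (𝔭A : ∀ x : MemberY d ℓ hd hL b₀ b₁ Mstar, HolderProbes (geo9Y x) (bg x) (XA x) (YA x) (PXA x) (PYA x))
    (𝔡A : ∀ x : MemberY d ℓ hd hL b₀ b₁ Mstar, DirOps310 (𝔬A x) (QA x))
    (𝔩A : ∀ x : MemberY d ℓ hd hL b₀ b₁ Mstar, DirLetters310 (𝔬A x) (QA x))
    (bHXA : ∀ x : MemberY d ℓ hd hL b₀ b₁ Mstar, ℝ → BlockNorm (toB6 (geo9Y x) 1 (H x)) (XA x → ℝ))
    (KA : ∀ x : MemberY d ℓ hd hL b₀ b₁ Mstar, B9.KernelFamily (geo9Y x) (bg x))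
    (evA : ∀ x : MemberY d ℓ hd hL b₀ b₁ Mstar, (geo9Y x).Loc → XA x → ℝ)
    (evYA : ∀ x : MemberY d ℓ hd hL b₀ b₁ Mstar, (geo9Y x).Loc → YA x → ℝ)
    (κA : MemberY d ℓ hd hL b₀ b₁ Mstar → Sizes310)
    (SHA S3A SIA SMA : ∀ x : MemberY d ℓ hd hL b₀ b₁ Mstar, ιA x → Finset (geo9Y x).Site)
    (hstA : ∀ x, StaticOK310 (𝔬A x) q.ρ q.Nc q.N' q.NF q.Cℓ (κA x)) (hκA : ∀ x, (κA x).Bounded q.Kc)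
    (hrdA : ∀ x, (rdA x).OK (𝔬A x).blk) (hlocA : ∀ x, Locality310 (𝔬A x) (rdA x))
    (h36A : ∀ x, q.M₁ ≤ (geo9Y x).M → ∀ α₀ : ℝ, 0 < α₀ → c35 * (geo9Y x).M * α₀ ≤ q.a₁ →
      ∀ U : (bg x).Cfg, (bg x).Reg335 c35 α₀ U →
        Local342G (𝔬A x) 1 (H x) q.B₀ q.δ₀ U ∧ B9Thm310Whole.Factors389 (𝔬A x) 1 (H x) q.θ₀ q.δ₀ U ∧
          DirSupSq310 (𝔬A x) (𝔡A x) 1 (H x) U ∧ Identities310₂ (𝔬A x) (𝔡A x) (𝔩A x) 1 (H x) U)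
    (h36HA : ∀ x, q.M₁ ≤ (geo9Y x).M → ∀ α₀ : ℝ, 0 < α₀ → c35 * (geo9Y x).M * α₀ ≤ q.a₁ →
      ∀ U : (bg x).Cfg, (bg x).Reg335 c35 α₀ U →
        HolderLegs310 (𝔬A x) (𝔭A x) 1 (H x) (SHA x) q.Bl q.δ₀ U ∧ FactorsHolder310 (𝔬A x) (𝔭A x) 1 (H x) q.Bt q.δ₀ U ∧
          (L2SecondLegs310 (𝔬A x) (𝔡A x) 1 (H x) (S3A x) q3.B3 q.δ₀ U ∧ FactorsL2Second310 (𝔬A x) (𝔡A x) 1 (H x) q3.θ3 q.δ₀ U ∧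
            DirTranspose310 (𝔬A x) (𝔡A x) U) ∧
            (InputLegsPair310 (𝔬A x) (𝔡A x) (𝔭A x) 1 (H x) (bHXA x) (SIA x) q.BI q.BI2 q.δ₀ U ∧
              FactorsInputPair310 (𝔬A x) (𝔡A x) 1 (H x) (bHXA x) q.θI q.δ₀ U ∧ DirSupHolder310 (𝔬A x) (𝔡A x) (𝔭A x) 1 (H x) U) ∧
              (L2MixedLegs310 (𝔬A x) (𝔡A x) 1 (H x) (SMA x) qM.BM q.δ₀ U ∧ FactorsL2Mixed310 (𝔬A x) (𝔡A x) 1 (H x) qM.θM q.δ₀ U ∧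
                DirSup310 (𝔬A x) (𝔡A x) 1 (H x) U))
    (hcoA0 : ∀ x U, CoRealizesRel (KA x) 0 U (Rel x) (𝔬A x).blk (𝔬A x).blk (evA x) ((𝔬A x).G U))
    (hcoA1 : ∀ x U, CoRealizesRel (KA x) 1 U (Rel x) (𝔬A x).blkY (𝔬A x).blk (evA x) ((𝔬A x).D U ∘ₗ (𝔬A x).G U))
    (hcoA2 : ∀ x U, CoRealizesRel (KA x) 2 U (Rel x) (𝔬A x).blk (𝔬A x).blkY (evYA x) ((𝔬A x).G U ∘ₗ (𝔬A x).Dstar U))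
    (hcoA3 : ∀ x U, CoRealizesRel (KA x) 3 U (Rel x) (𝔬A x).blk (𝔬A x).blk (evA x) ((𝔬A x).Lap U ∘ₗ (𝔬A x).G U))
    (hglA0 : ∀ x U, GlobReads (KA x) 0 U (𝔬A x).blk (𝔬A x).blk (evA x) ((𝔬A x).G U))
    (hglA1 : ∀ x U, GlobReads (KA x) 1 U (𝔬A x).blkY (𝔬A x).blk (evA x) ((𝔬A x).D U ∘ₗ (𝔬A x).G U))
    (hglA2 : ∀ x U, GlobReads (KA x) 2 U (𝔬A x).blk (𝔬A x).blkY (evYA x) ((𝔬A x).G U ∘ₗ (𝔬A x).Dstar U))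
    (hglA3 : ∀ x U, GlobReads (KA x) 3 U (𝔬A x).blk (𝔬A x).blk (evA x) ((𝔬A x).Lap U ∘ₗ (𝔬A x).G U))
    (hlA0 : ∀ x U, L2ReadsNbr (R := 1) (H := H x) (KA x) 0 U (Rel x) 2 Cev (𝔬A x).blk (𝔬A x).blk (evA x) ((𝔬A x).G U))
    (hlA1 : ∀ x U, L2ReadsNbr (R := 1) (H := H x) (KA x) 1 U (Rel x) 2 Cev (𝔬A x).blkY (𝔬A x).blk (evA x) ((𝔬A x).D U ∘ₗ (𝔬A x).G U))
    (hlA2 : ∀ x U, L2ReadsNbr (R := 1) (H := H x) (KA x) 2 U (Rel x) 2 Cev (𝔬A x).blk (𝔬A x).blkY (evYA x) ((𝔬A x).G U ∘ₗ (𝔬A x).Dstar U))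
    (hlA3 : ∀ x U, L2ReadsNbr (R := 1) (H := H x) (KA x) 3 U (Rel x) 2 Cev ((𝔬A x).blk ∘ Prod.fst) (𝔬A x).blk (evA x)
      (familyOp fun p : QA x × QA x => (𝔡A x).Dd U p.1 ∘ₗ ((𝔬A x).G U ∘ₗ (𝔡A x).Dsd U p.2)))
    (hlA4 : ∀ x U, L2ReadsNbr (R := 1) (H := H x) (KA x) 4 U (Rel x) 2 Cev ((𝔬A x).blk ∘ Prod.fst) (𝔬A x).blk (evA x)
      (familyOp fun p : QA x × QA x => ((𝔡A x).Dd U p.1 ∘ₗ (𝔡A x).Dd U p.2) ∘ₗ (𝔬A x).G U))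
    (hlA5 : ∀ x U, L2ReadsNbr (R := 1) (H := H x) (KA x) 5 U (Rel x) 2 Cev ((𝔬A x).blk ∘ Prod.fst) (𝔬A x).blk (evA x)
      (familyOp fun p : QA x × QA x => (𝔬A x).G U ∘ₗ ((𝔡A x).Dsd U p.1 ∘ₗ (𝔡A x).Dsd U p.2)))
    (hH1A : ∀ x U, H1ReadsNbr (KA x) U (𝔭A x) (Rel x) 2 (𝔬A x).blk (𝔬A x).blkY (evA x) (evYA x) ((𝔬A x).D U ∘ₗ (𝔬A x).G U)
      ((𝔬A x).G U ∘ₗ (𝔬A x).Dstar U))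
    (hIRA : ∀ x U, InputReadsFam (KA x) U (bHXA x) 2 ((𝔬A x).blk ∘ Prod.fst) ((𝔭A x).blkPX ∘ Prod.fst)
      (fun β => sliceProbe ((𝔭A x).ΦX U β)) (evA x)
      (familyOp fun p : QA x × QA x => (𝔡A x).Dd U p.1 ∘ₗ ((𝔬A x).G U ∘ₗ (𝔡A x).Dsd U p.2)))
    (hsymA : ∀ x, q.M₁ ≤ (geo9Y x).M → ∀ α₀ : ℝ, 0 < α₀ → c35 * (geo9Y x).M * α₀ ≤ q.a₁ →
      ∀ U : (bg x).Cfg, (bg x).Reg335 c35 α₀ U → IsTransposePair ((𝔬A x).G U) ((𝔬A x).G U))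
    (htrA : ∀ x, q.M₁ ≤ (geo9Y x).M → ∀ α₀ : ℝ, 0 < α₀ → c35 * (geo9Y x).M * α₀ ≤ q.a₁ →
      ∀ U : (bg x).Cfg, (bg x).Reg335 c35 α₀ U → IsTransposePair ((𝔬A x).D U ∘ₗ (𝔬A x).G U) ((𝔬A x).G U ∘ₗ (𝔬A x).Dstar U))
    (hcntHA : ∀ x (a : (geo9Y x).Site), (∑ c, if a ∈ SHA x c then (1 : ℝ) else 0) ≤ q.NH)
    (hcnt3A : ∀ x (a : (geo9Y x).Site), (∑ c, if a ∈ S3A x c then (1 : ℝ) else 0) ≤ q3.N3)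
    (hNQA : ∀ x, (Fintype.card (QA x) : ℝ) ≤ NQ)
    (hcntIA : ∀ x (a : (geo9Y x).Site), (∑ c, if a ∈ SIA x c then (1 : ℝ) else 0) ≤ q.NI)
    (hcntMA : ∀ x (a : (geo9Y x).Site), (∑ c, if a ∈ SMA x c then (1 : ℝ) else 0) ≤ qM.NM) :
    B9.Thm37Printed c35 geo9Y bg (fun x => E37YPairMDir (bg := bg) m mN Cev NQ p q p3 q3 pM qM (𝔬 x) (𝔡 x) (𝔩 x) (rd x) (H x) (K x)) ∧
      B9.Cor38Printed c35 geo9Y bg (fun x => E37YPairMDir (bg := bg) m mN Cev NQ p q p3 q3 pM qM (𝔬 x) (𝔡 x) (𝔩 x) (rd x) (H x) (K x)) ∧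
      B9.Thm310Printed c35 geo9Y bg (fun x => E310YPairM (bg := bg) m mN Cev NQ p q p3 q3 pM qM (𝔬A x) (rdA x) (H x) (KA x)) ∧
      B9.RWSumsYieldIneqs geo9Y bg (fun x => E37YPairMDir (bg := bg) m mN Cev NQ p q p3 q3 pM qM (𝔬 x) (𝔡 x) (𝔩 x) (rd x) (H x) (K x))
        (fun x => E310YPairM (bg := bg) m mN Cev NQ p q p3 q3 pM qM (𝔬A x) (rdA x) (H x) (KA x)) K KA := by
  set dp : ℕ := exp261 (@geo9Y d ℓ hd hL b₀ b₁ Mstar) p.δ₀ p.α with hdp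
  set dFp : ℕ := exp261 (@geo9Y d ℓ hd hL b₀ b₁ Mstar) ((1 - 2 * p.α) * p.δ₀) (1 - p.αF) with hdFp
  set dq : ℕ := exp261 (@geo9Y d ℓ hd hL b₀ b₁ Mstar) q.δ₀ q.α with hdq
  set dFq : ℕ := exp261 (@geo9Y d ℓ hd hL b₀ b₁ Mstar) ((1 - 2 * q.α) * q.δ₀) (1 - q.αF) with hdFq
  set L₀ : ℝ := ((ℓ + 1 : ℕ) : ℝ) with hL₀
  have hL₀0 : 0 ≤ L₀ := by rw [hL₀]; positivity
  have hB1Y : 0 ≤ B1Y p q dp dFp dq dFq L₀ := (B1Y_pos p q dp dFp dq dFq L₀).le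
  obtain ⟨hN3p, hB3p, hθ3p⟩ := hp3
  obtain ⟨hN3q, hB3q, hθ3q⟩ := hq3
  have hCp0 : 0 ≤ p.C dp := PinPrims.C_nonneg hp dp
  have hCq0 : 0 ≤ q.C dq := PinPrims.C_nonneg hq dq
  have hscp : 0 ≤ secondConst dp p.δ₀ p.α p3.N3 p3.B3 p.N' p3.θ3 (p.C dp) L₀ := secondConst_nonneg hN3p hB3p hp.N'_nn hθ3p hCp0 hL₀0
  have hscq : 0 ≤ secondConst dq q.δ₀ q.α q3.N3 q3.B3 q.NF q3.θ3 (q.C dq) L₀ := secondConst_nonneg hN3q hB3q hq.NF_nn hθ3q hCq0 hL₀0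
  obtain ⟨hNMp, hBMp, hθMp⟩ := hpM
  obtain ⟨hNMq, hBMq, hθMq⟩ := hqM
  have hmcp : 0 ≤ mixedConst dp p.δ₀ p.α pM.NM pM.BM p.N' pM.θM (p.C dp) L₀ := mixedConst_nonneg hNMp hBMp hp.N'_nn hθMp hCp0 hL₀0
  have hmcq : 0 ≤ mixedConst dq q.δ₀ q.α qM.NM qM.BM q.NF qM.θM (q.C dq) L₀ := mixedConst_nonneg hNMq hBMq hq.NF_nn hθMq hCq0 hL₀0
  have hB1le₀ : B1Y p q dp dFp dq dFq L₀ ≤ B1Pair p q p3 q3 NQ dp dFp dq dFq L₀ :=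
    le_add_of_nonneg_right (mul_nonneg hNQ0 (add_nonneg hscp hscq))
  have hPM : B1Pair p q p3 q3 NQ dp dFp dq dFq L₀ ≤ B1PairM p q p3 q3 pM qM NQ dp dFp dq dFq L₀ :=
    le_add_of_nonneg_right (mul_nonneg hNQ0 (add_nonneg hmcp hmcq))
  have hB1le : B1Y p q dp dFp dq dFq L₀ ≤ B1PairM p q p3 q3 pM qM NQ dp dFp dq dFq L₀ := hB1le₀.trans hPM
  have hB1P0 : 0 ≤ B1Pair p q p3 q3 NQ dp dFp dq dFq L₀ := hB1Y.trans hB1le₀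
  have hBp := (lowerB_le_B1Y_left'' p q dp dFp dq dFq L₀).trans hB1le
  have hBq := (lowerB_le_B1Y_right'' p q dp dFp dq dFq L₀).trans hB1le
  have hB1 : 0 ≤ B1PairM p q p3 q3 pM qM NQ dp dFp dq dFq L₀ := hB1Y.trans hB1le
  have hB1pos : 0 < B1PairM p q p3 q3 pM qM NQ dp dFp dq dFq L₀ := lt_of_lt_of_le (B1Y_pos p q dp dFp dq dFq L₀) hB1le
  have h35p : NQ * secondConst dp p.δ₀ p.α p3.N3 p3.B3 p.N' p3.θ3 (p.C dp) L₀ ≤ B1PairM p q p3 q3 pM qM NQ dp dFp dq dFq L₀ :=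
    calc NQ * secondConst dp p.δ₀ p.α p3.N3 p3.B3 p.N' p3.θ3 (p.C dp) L₀
        ≤ NQ * secondConst dp p.δ₀ p.α p3.N3 p3.B3 p.N' p3.θ3 (p.C dp) L₀ +
          (B1Y p q dp dFp dq dFq L₀ + NQ * secondConst dq q.δ₀ q.α q3.N3 q3.B3 q.NF q3.θ3 (q.C dq) L₀) :=
          le_add_of_nonneg_right (add_nonneg hB1Y (mul_nonneg hNQ0 hscq))
      _ = B1Pair p q p3 q3 NQ dp dFp dq dFq L₀ := by unfold B1Pair; ring
      _ ≤ B1PairM p q p3 q3 pM qM NQ dp dFp dq dFq L₀ := hPM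
  have h35q : NQ * secondConst dq q.δ₀ q.α q3.N3 q3.B3 q.NF q3.θ3 (q.C dq) L₀ ≤ B1PairM p q p3 q3 pM qM NQ dp dFp dq dFq L₀ :=
    calc NQ * secondConst dq q.δ₀ q.α q3.N3 q3.B3 q.NF q3.θ3 (q.C dq) L₀
        ≤ NQ * secondConst dq q.δ₀ q.α q3.N3 q3.B3 q.NF q3.θ3 (q.C dq) L₀ +
          (B1Y p q dp dFp dq dFq L₀ + NQ * secondConst dp p.δ₀ p.α p3.N3 p3.B3 p.N' p3.θ3 (p.C dp) L₀) :=
          le_add_of_nonneg_right (add_nonneg hB1Y (mul_nonneg hNQ0 hscp))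
      _ = B1Pair p q p3 q3 NQ dp dFp dq dFq L₀ := by unfold B1Pair; ring
      _ ≤ B1PairM p q p3 q3 pM qM NQ dp dFp dq dFq L₀ := hPM
  have hMp : NQ * mixedConst dp p.δ₀ p.α pM.NM pM.BM p.N' pM.θM (p.C dp) L₀ ≤ B1PairM p q p3 q3 pM qM NQ dp dFp dq dFq L₀ :=
    calc NQ * mixedConst dp p.δ₀ p.α pM.NM pM.BM p.N' pM.θM (p.C dp) L₀
        ≤ NQ * mixedConst dp p.δ₀ p.α pM.NM pM.BM p.N' pM.θM (p.C dp) L₀ +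
          (B1Pair p q p3 q3 NQ dp dFp dq dFq L₀ + NQ * mixedConst dq q.δ₀ q.α qM.NM qM.BM q.NF qM.θM (q.C dq) L₀) :=
          le_add_of_nonneg_right (add_nonneg hB1P0 (mul_nonneg hNQ0 hmcq))
      _ = B1PairM p q p3 q3 pM qM NQ dp dFp dq dFq L₀ := by unfold B1PairM; ring
  have hMq : NQ * mixedConst dq q.δ₀ q.α qM.NM qM.BM q.NF qM.θM (q.C dq) L₀ ≤ B1PairM p q p3 q3 pM qM NQ dp dFp dq dFq L₀ :=
    calc NQ * mixedConst dq q.δ₀ q.α qM.NM qM.BM q.NF qM.θM (q.C dq) L₀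
        ≤ NQ * mixedConst dq q.δ₀ q.α qM.NM qM.BM q.NF qM.θM (q.C dq) L₀ +
          (B1Pair p q p3 q3 NQ dp dFp dq dFq L₀ + NQ * mixedConst dp p.δ₀ p.α pM.NM pM.BM p.N' pM.θM (p.C dp) L₀) :=
          le_add_of_nonneg_right (add_nonneg hB1P0 (mul_nonneg hNQ0 hmcp))
      _ = B1PairM p q p3 q3 pM qM NQ dp dFp dq dFq L₀ := by unfold B1PairM; ring
  -- the scale and its order facts
  have hδ1 : 0 < delta1Y p q := delta1Y_pos hp hq
  have he0 : 0 ≤ Real.exp (2 * delta1Y p q) := Real.exp_nonneg _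
  have hL1 : (1 : ℝ) ≤ L₀ := by rw [hL₀]; exact_mod_cast Nat.succ_le_succ (Nat.zero_le ℓ)
  have hm0 : (0 : ℝ) ≤ m := Nat.cast_nonneg m
  obtain ⟨hs1, hsm, hsL2, hsmL, hse, hsLe⟩ := nbrScale_facts m mN hCev hL1 hδ1.le
  set s : ℝ := nbrScale m mN Cev L₀ (delta1Y p q) with hsname
  have hs0 : (0 : ℝ) ≤ s := zero_le_one.trans hs1
  -- the scaled relations: k·X ≤ s·B for 0 ≤ k ≤ s, 0 ≤ X ≤ B; X ≤ s·B for X ≤ B, 0 ≤ B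
  have scK : ∀ {k X B : ℝ}, 0 ≤ k → k ≤ s → 0 ≤ X → X ≤ B → k * X ≤ s * B := fun hk hks hX hXB =>
    mul_le_mul hks hXB hX hs0
  have sc0 : ∀ {X B : ℝ}, X ≤ B → 0 ≤ B → X ≤ s * B := fun hXB hB => hXB.trans (le_mul_of_one_le_left hB hs1)
  have hmLe0 : 0 ≤ (m : ℝ) * L₀ * Real.exp (2 * delta1Y p q) := by positivity
  have hAe0 : 0 ≤ (mN : ℝ) * m * Cev * L₀ ^ 2 * Real.exp (2 * delta1Y p q) := by positivity
  have hLe0 : 0 ≤ L₀ * Real.exp (2 * delta1Y p q) := by positivity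
  have hCp : 0 ≤ p.C dp := PinPrims.C_nonneg hp dp
  have hCq : 0 ≤ q.C dq := PinPrims.C_nonneg hq dq
  have hc1p : 0 ≤ B6.c1 dp p.δ₀ p.α := c1_nonneg _ _ _
  have hc1q : 0 ≤ B6.c1 dq q.δ₀ q.α := c1_nonneg _ _ _
  have hhold_p : ∀ β, 0 ≤ β → β < 1 → 0 ≤ holderConst dp p.δ₀ p.α p.NH p.N' (p.C dp) (p.Bl β) (p.Bt β) := by
    intro β h0 h1
    have := hp.NH_nn; have := hp.N'_nn; have := hp.Bl_nn β h0 h1; have := hp.Bt_nn β h0 h1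
    unfold holderConst; positivity
  have hhold_q : ∀ β, 0 ≤ β → β < 1 → 0 ≤ holderConst dq q.δ₀ q.α q.NH q.NF (q.C dq) (q.Bl β) (q.Bt β) := by
    intro β h0 h1
    have := hq.NH_nn; have := hq.NF_nn; have := hq.Bl_nn β h0 h1; have := hq.Bt_nn β h0 h1
    unfold holderConst; positivity
  have hin44_p : ∀ ε, 0 < ε → ε ≤ 1 → 0 ≤ inputConst44 dp p.δ₀ p.α p.NI p.N' (p.C dp) L₀ (p.BI ε) (p.θI ε) := by
    intro ε h0 h1
    have := hp.NI_nn; have := hp.N'_nn; have := hp.BI_nn ε h0 h1; have := hp.θI_nn ε h0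
    unfold inputConst44; positivity
  have hin44_q : ∀ ε, 0 < ε → ε ≤ 1 → 0 ≤ inputConst44 dq q.δ₀ q.α q.NI q.NF (q.C dq) L₀ (q.BI ε) (q.θI ε) := by
    intro ε h0 h1
    have := hq.NI_nn; have := hq.NF_nn; have := hq.BI_nn ε h0 h1; have := hq.θI_nn ε h0
    unfold inputConst44; positivity
  have hin45_p : ∀ ε β, 0 < ε → ε ≤ 1 → 0 ≤ β → β < 1 →
      0 ≤ inputConst45 dp p.δ₀ p.α p.NI p.N' L₀ (holderConst dp p.δ₀ p.α p.NH p.N' (p.C dp) (p.Bl β) (p.Bt β)) (p.BI2 ε β)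
        (p.θI (β + ε)) := by
    intro ε β h0 h1 hβ0 hβ1
    have := hp.NI_nn; have := hp.N'_nn; have := hp.BI2_nn ε β h0 h1 hβ0 hβ1; have := hp.θI_nn (β + ε) (by linarith)
    have := hhold_p β hβ0 hβ1
    unfold inputConst45; positivity
  have hin45_q : ∀ ε β, 0 < ε → ε ≤ 1 → 0 ≤ β → β < 1 →
      0 ≤ inputConst45 dq q.δ₀ q.α q.NI q.NF L₀ (holderConst dq q.δ₀ q.α q.NH q.NF (q.C dq) (q.Bl β) (q.Bt β)) (q.BI2 ε β)
        (q.θI (β + ε)) := by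
    intro ε β h0 h1 hβ0 hβ1
    have := hq.NI_nn; have := hq.NF_nn; have := hq.BI2_nn ε β h0 h1 hβ0 hβ1; have := hq.θI_nn (β + ε) (by linarith)
    have := hhold_q β hβ0 hβ1
    unfold inputConst45; positivity
  obtain ⟨t37, c38⟩ := thm37_cor38_complete_geo9Y_pairM_dir (bg := bg) (B₁ := s * B1PairM p q p3 q3 pM qM NQ dp dFp dq dFq L₀)
    (δ₁ := delta1Y p q) (Bβ := fun β => s * BbetaY p q dp dq β) (Bε := fun ε => s * BepsY p q dp dq L₀ ε)
    (Bεβ := fun ε β => s * BepsbetaY p q dp dq L₀ ε β) 𝔬 rd H 𝔭 𝔡 𝔩 bHX K ev evY Rel m Cev mN hRlen hRd₁ hRd₂ hmult hnbr hCev κ SH S3 SI SM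
    p.Bl p.Bt p.BI p.θI p.BI2 p.α p.ρ p.Nc p.N' p.Cℓ p.Kc p.θ₀ p.B₀ p.δ₀ p.a₁ p.M₁ p.αF p.NH p3.N3 p3.B3 p3.θ3 NQ p.NI pM.NM pM.BM pM.θM hc
    hp.α_pos hp.α_lt hp.Nc_nn hp.N'_nn hp.one_le_Cℓ hp.Kc_nn hp.θ₀_nn hp.B₀_pos hp.δ₀_pos hp.a₁_pos hp.M₁_pos hp.αF_pos
    hp.αF_lt.le hp.NH_nn hN3p hB3p hθ3p hp.NI_nn hNMp hBMp hθMp hst hκ hrd hloc h36 h36H hco0 hco1 hco2 hco3 hgl0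
    hgl1 hgl2 hgl3 hl0 hl1 hl2 hl3 hl4 hl5 hH1 hIR hsym htr hcntH hcnt3 hNQ hcntI hcntM hp.Bl_nn hp.Bt_nn hp.BI_nn hp.BI2_nn
    hp.θI_nn (scK hm0 hsm hCp ((le_pinLowerB₁'' _ _ _ _ _).trans hBp))
    (scK hAe0 hsL2 (mul_nonneg hCp hL₀0) ((le_pinLowerB₂'' _ _ _ _ _).trans hBp)) hδ1.le (min_le_left _ _)
    (sc0 ((le_pinLowerB₃'' _ _ _ _ _).trans hBp) hB1)
    (scK hAe0 hsL2 (mul_nonneg hNQ0 hscp) h35p)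
    (scK hAe0 hsL2 (mul_nonneg hNQ0 hmcp) hMp)
    (fun β h0 h1 => scK hmLe0 hsmL (hhold_p β h0 h1) (le_max_left _ _))
    (fun ε h0 h1 => scK he0 hse (hin44_p ε h0 h1) (le_max_left _ _))
    (fun ε β h0 h1 hβ0 hβ1 => scK hLe0 hsLe (hin45_p ε β h0 h1 hβ0 hβ1) (le_max_left _ _))
  have t310 := thm310_complete_geo9Y_pairM_dir (bg := bg) (B₁ := s * B1PairM p q p3 q3 pM qM NQ dp dFp dq dFq L₀) (δ₁ := delta1Y p q)
    (Bβ := fun β => s * BbetaY p q dp dq β) (Bε := fun ε => s * BepsY p q dp dq L₀ ε)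
    (Bεβ := fun ε β => s * BepsbetaY p q dp dq L₀ ε β) 𝔬A rdA H 𝔭A 𝔡A 𝔩A bHXA KA evA evYA Rel m Cev mN hRlen hRd₁ hRd₂ hmult hnbr hCev
    κA SHA S3A SIA SMA q.Bl q.Bt q.BI q.θI q.BI2 q.α q.ρ q.Nc q.N' q.NF q.Cℓ q.Kc q.θ₀ q.B₀ q.δ₀ q.a₁ q.M₁ q.αF q.NH q3.N3 q3.B3 q3.θ3
    NQ q.NI qM.NM qM.BM qM.θM hc hq.α_pos hq.α_lt hq.Nc_nn hq.N'_nn hq.NF_nn hq.one_le_Cℓ hq.Kc_nn hq.θ₀_nn hq.B₀_pos hq.δ₀_pos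
    hq.a₁_pos hq.M₁_pos hq.αF_pos hq.αF_lt.le hq.NH_nn hN3q hB3q hθ3q hq.NI_nn hNMq hBMq hθMq hstA hκA hrdA hlocA h36A h36HA
    hcoA0 hcoA1 hcoA2 hcoA3 hglA0 hglA1 hglA2 hglA3 hlA0 hlA1 hlA2 hlA3 hlA4 hlA5 hH1A hIRA hsymA htrA hcntHA hcnt3A hNQA hcntIA
    hcntMA hq.Bl_nn hq.Bt_nn hq.BI_nn hq.BI2_nn hq.θI_nn
    (scK hm0 hsm hCq ((le_pinLowerB₁'' _ _ _ _ _).trans hBq))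
    (scK hAe0 hsL2 (mul_nonneg hCq hL₀0) ((le_pinLowerB₂'' _ _ _ _ _).trans hBq)) hδ1.le (min_le_right _ _)
    (sc0 ((le_pinLowerB₃'' _ _ _ _ _).trans hBq) hB1)
    (scK hAe0 hsL2 (mul_nonneg hNQ0 hscq) h35q)
    (scK hAe0 hsL2 (mul_nonneg hNQ0 hmcq) hMq)
    (fun β h0 h1 => scK hmLe0 hsmL (hhold_q β h0 h1) (le_max_right _ _))
    (fun ε h0 h1 => scK he0 hse (hin44_q ε h0 h1) (le_max_right _ _))
    (fun ε β h0 h1 hβ0 hβ1 => scK hLe0 hsLe (hin45_q ε β h0 h1 hβ0 hβ1) (le_max_right _ _))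
  exact ⟨t37, c38, t310, rwSumsYieldIneqs_allPins _ 𝔬 (fun _ => 1) H _ _ 𝔬A rdA (fun _ => 1) H _ _ K KA _ _ _
    (mul_pos (lt_of_lt_of_le one_pos hs1) hB1pos) (delta1Y_pos hp hq)⟩

end StageY

end

end Literature.MathematicalPhysics.QuantumFieldTheory.Balaban1983to89.B9RWSumsDefinitePinsPairMDirA
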